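import Mathlib
import Summits.Ventures.PercRepro2.SwOutSevEsc

/-!
# The escaping points of a several-arms block, II: the base read off a slab point (blind cell
PercRepro2, night-4 g22, 2026-08-27; proofs/NIGHT4-G22.md §5)

The base is READ OFF an escaping point by `baseER`: the all-red orientation with the u–`p r`
edges red and the edges from the dropped vertices out of the region blue (**`baseER_esc`**:
`baseER (mixedRealR σ q) = σ` at every slab point, for any family `p₀` of forced vertices whose
u-edges are red and whose edges out of the region are blue at the base and which covers the
u–`p r` and outside classes).  A vertex of the blue cluster of `h` in a u-arm, a piece or a far
arm makes that arm blue (`s_false_of_mem_blue_U`, `a_false_of_mem_blue_Ah`,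
`f_false_of_mem_blue_F`).
-/

namespace Summit.Ventures.PercRepro2

namespace MixedArms

open Hull LocRows BigBlock

variable {V : Type*} {E : Type*} [Fintype E] [DecidableEq E]

open scoped Classical

section BaseE

variable (ends : E → Sym2 V) (Us : Set V) (h u : V) {ρ : Type*} (p : ρ → V)

/-- The base read off an escaping point: the all-red orientation with the u–`p r` edges red and
the edges from the dropped vertices out of the region blue. -/
noncomputable def baseER (ζ : Config E) : Config E := fun e =>
  if ∃ r, ends e = s(u, p r) then true
  else if ∃ r x, ends e = s(p r, x) ∧ x ∉ Us then false
  else allRed ends ζ h e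

end BaseE

variable {ι ρ ν κ : Type*} {ends : E → Sym2 V} {σ : Config E} {h u : V} {U : ι → Set V}
  {p : ρ → V} {Ah : ν → Set V} {arm : ν → ρ} {F : κ → Set V}

variable (hb : MixedBaseR ends σ h u U p Ah arm F)
include hb

section BaseE

variable (hup : ∀ r, ∃ e, ends e = s(u, p r))
include hup

omit [Fintype E] [DecidableEq E] in
/-- A vertex of the blue cluster of `h` in a u-arm: the u-arm is blue. -/
lemma MixedBaseR.s_false_of_mem_blue_U {q : PtR ι ρ ν κ} (hqB : ¬ LeakBR arm q) {j : ι} {x : V}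
    (hx : x ∈ U j) (hxB : x ∈ cluster ends (blue (mixedRealR ends u U p Ah F σ q)) h) :
    q.1 j = false := by
  rw [hb.cluster_blue_mixedRealR hup hqB, mem_redSetR_iff] at hxB
  rcases hxB with rfl | ⟨j', hj', hx'⟩ | ⟨rfl, -⟩ | ⟨r, rfl, -, -⟩ | ⟨i, -, hx'⟩ | ⟨k, -, hx'⟩
  · exact absurd hx (hb.h_notMem_U j)
  · by_cases hjj : j = j'
    · subst hjj; rw [flipPt_fst] at hj'; simpa using hj'
    · exact absurd hx' (hb.U_disj j j' hjj x hx)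
  · exact absurd hx (hb.u_notMem_U j)
  · exact absurd hx (hb.p_notMem_U r j)
  · exact absurd hx' (hb.U_disj_Ah j i x hx)
  · exact absurd hx' (hb.U_disj_F j k x hx)

omit [Fintype E] [DecidableEq E] in
/-- A vertex of the blue cluster of `h` in a piece: the piece is blue. -/
lemma MixedBaseR.a_false_of_mem_blue_Ah {q : PtR ι ρ ν κ} (hqB : ¬ LeakBR arm q) {i : ν} {x : V}
    (hx : x ∈ Ah i) (hxB : x ∈ cluster ends (blue (mixedRealR ends u U p Ah F σ q)) h) :
    q.2.1 i = false := by
  rw [hb.cluster_blue_mixedRealR hup hqB, mem_redSetR_iff] at hxB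
  rcases hxB with rfl | ⟨j, -, hx'⟩ | ⟨rfl, -⟩ | ⟨r, rfl, -, -⟩ | ⟨i', hi', hx'⟩ | ⟨k, -, hx'⟩
  · exact absurd hx (hb.h_notMem_Ah i)
  · exact absurd hx (hb.U_disj_Ah j i x hx')
  · exact absurd hx (hb.u_notMem_Ah i)
  · exact absurd hx (hb.p_notMem_Ah r i)
  · by_cases hii : i = i'
    · subst hii; rw [flipPt_a] at hi'; simpa using hi'
    · exact absurd hx' (hb.Ah_disj i i' hii x hx)
  · exact absurd hx' (hb.Ah_disj_F i k x hx)

omit [Fintype E] [DecidableEq E] in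
/-- A vertex of the blue cluster of `h` in a far arm: the far arm is blue. -/
lemma MixedBaseR.f_false_of_mem_blue_F {q : PtR ι ρ ν κ} (hqB : ¬ LeakBR arm q) {k : κ} {x : V}
    (hx : x ∈ F k) (hxB : x ∈ cluster ends (blue (mixedRealR ends u U p Ah F σ q)) h) :
    q.2.2.2.2 k = false := by
  rw [hb.cluster_blue_mixedRealR hup hqB, mem_redSetR_iff] at hxB
  rcases hxB with rfl | ⟨j, -, hx'⟩ | ⟨rfl, -⟩ | ⟨r, rfl, -, -⟩ | ⟨i, -, hx'⟩ | ⟨k', hk', hx'⟩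
  · exact absurd hx (hb.h_notMem_F k)
  · exact absurd hx (hb.U_disj_F j k x hx')
  · exact absurd hx (hb.u_notMem_F k)
  · exact absurd hx (hb.p_notMem_F r k)
  · exact absurd hx (hb.Ah_disj_F i k x hx')
  · by_cases hkk : k = k'
    · subst hkk; rw [flipPt_f] at hk'; simpa using hk'
    · exact absurd hx' (hb.F_disj k k' hkk x hx)

variable {Us : Set V} {ρ₀ : Type*} {p₀ : ρ₀ → V}
  (hp₀red : ∀ r e, ends e = s(u, p₀ r) → σ e = true)
  (hp₀blue : ∀ r e x, ends e = s(p₀ r, x) → x ∉ Us → σ e = false)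
  (hUP₀ : ∀ r e, e ∈ clsUPR ends u p r → ∃ r₀, ends e = s(u, p₀ r₀))
  (hX₀ : ∀ r e, e ∈ clsExtR ends u p Ah r → ∃ r₀ x, ends e = s(p₀ r₀, x) ∧ x ∉ Us)
include hp₀red hp₀blue hUP₀ hX₀

omit [Fintype E] [DecidableEq E] in
/-- **The base is read off every slab point** (with a u-arm). -/
theorem MixedBaseR.baseER_esc [Nonempty ι] {q : PtR ι ρ ν κ} (hq : TSlab q arm ∨ BSlab q arm) :
    baseER ends Us h u p₀ (mixedRealR ends u U p Ah F σ q) = σ := by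
  have hnl : ¬ Leak q arm := (not_leak_iff arm q).2 (Or.inr hq)
  obtain ⟨hqR, hqB⟩ := not_leak_iff_RB.1 hnl
  set ζ' := mixedRealR ends u U p Ah F σ q with hζ'
  set B := cluster ends (blue ζ') h \ {h} with hBdef
  have hBsub : ∀ z ∈ B, z ∈ {h} ∪ {u} ∪ Set.range p ∪ armsAllR U Ah F := by
    intro z hz
    have := hz.1
    rw [hζ', hb.cluster_blue_mixedRealR hup hqB] at this
    exact redSetR_subset this
  -- `u` is in the blue cluster of `h` iff some u-arm is blue iff all are (the slab)
  have hs_const : (∀ j, q.1 j = true) ∨ ∀ j, q.1 j = false := by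
    rcases hq with ⟨hs, -⟩ | ⟨hs, -⟩
    · exact Or.inl fun j => by rw [hs]
    · exact Or.inr fun j => by rw [hs]
  have huB : u ∈ cluster ends (blue ζ') h ↔ ∀ j, q.1 j = false := by
    rw [hζ', hb.cluster_blue_mixedRealR hup hqB, mem_redSetR_iff]
    constructor
    · rintro (h' | ⟨j, -, hx⟩ | ⟨-, j, hj⟩ | ⟨r, hr, -⟩ | ⟨i, -, hx⟩ | ⟨k, -, hx⟩)
      · exact absurd h' hb.hne_hu.symm
      · exact absurd hx (hb.u_notMem_U j)
      · rw [flipPt_fst] at hj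
        rcases hs_const with hs | hs
        · rw [hs j] at hj; exact absurd hj (by decide)
        · exact hs
      · exact absurd hr (hb.hne_up r)
      · exact absurd hx (hb.u_notMem_Ah i)
      · exact absurd hx (hb.u_notMem_F k)
    · intro hs
      obtain ⟨j⟩ := ‹Nonempty ι›
      exact Or.inr (Or.inr (Or.inl ⟨rfl, j, by rw [flipPt_fst, hs j]; rfl⟩))
  funext e
  unfold baseER
  by_cases h1 : ∃ r, ends e = s(u, p₀ r)
  · rw [if_pos h1]
    obtain ⟨r, hr⟩ := h1
    exact (hp₀red r e hr).symm
  by_cases h2 : ∃ r x, ends e = s(p₀ r, x) ∧ x ∉ Us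
  · rw [if_neg h1, if_pos h2]
    obtain ⟨r, x, hx, hxU⟩ := h2
    exact (hp₀blue r e x hx hxU).symm
  rw [if_neg h1, if_neg h2]
  show flip ends B ζ' e = σ e
  have hhB : h ∉ B := fun hh => hh.2 rfl
  by_cases hU : ∃ j, e ∈ touches ends (U j)
  · obtain ⟨j, hj⟩ := hU
    have hmem : e ∈ touches ends B ↔ q.1 j = false := by
      obtain ⟨x, y, hxy, hx, hy⟩ := hb.ends_of_touches_U hj
      constructor
      · rintro ⟨z, hzB, w, hzw⟩
        have hz : z = x ∨ z = y := by
          rw [hxy, Sym2.eq_iff] at hzw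
          rcases hzw with ⟨h1, _⟩ | ⟨_, h2⟩
          · exact Or.inl h1.symm
          · exact Or.inr h2.symm
        rcases hz with rfl | rfl
        · exact hb.s_false_of_mem_blue_U hup hqB hx hzB.1
        · rcases hy with hy | rfl | rfl | ⟨hyh, hyu, hyp, hyo⟩
          · exact hb.s_false_of_mem_blue_U hup hqB hy hzB.1
          · exact absurd hzB hhB
          · exact (huB.1 hzB.1) j
          · exfalso
            rcases hBsub z hzB with ((h' | h') | ⟨r, hr⟩) | h'
            · exact hyh h'
            · exact hyu h'
            · exact hyp r hr.symm
            · exact hyo h'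
      · intro hs
        refine ⟨x, ⟨?_, fun h' => hb.h_notMem_U j (h' ▸ hx)⟩, y, hxy⟩
        rw [hζ', hb.cluster_blue_mixedRealR hup hqB, mem_redSetR_iff]
        exact Or.inr (Or.inl ⟨j, by rw [flipPt_fst, hs]; rfl, hx⟩)
    cases hs : q.1 j with
    | false =>
      rw [flip_apply_of_mem (hmem.2 hs), hζ', hb.mixedRealR_apply_U hj, hs, if_neg (by decide),
        Bool.not_not]
    | true =>
      rw [flip_apply_of_notMem (fun h' => by rw [hmem.1 h'] at hs; exact Bool.noConfusion hs), hζ',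
        hb.mixedRealR_apply_U hj, hs, if_pos rfl]
  by_cases hA : ∃ i, e ∈ touches ends (Ah i)
  · obtain ⟨i, hi⟩ := hA
    have hmem : e ∈ touches ends B ↔ q.2.1 i = false := by
      obtain ⟨x, y, hxy, hx, hy⟩ := hb.ends_of_touches_Ah hi
      constructor
      · rintro ⟨z, hzB, w, hzw⟩
        have hz : z = x ∨ z = y := by
          rw [hxy, Sym2.eq_iff] at hzw
          rcases hzw with ⟨h1, _⟩ | ⟨_, h2⟩
          · exact Or.inl h1.symm
          · exact Or.inr h2.symm
        rcases hz with rfl | rfl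
        · exact hb.a_false_of_mem_blue_Ah hup hqB hx hzB.1
        · rcases hy with hy | rfl | rfl | ⟨hyh, hyu, hyp, hyo⟩
          · exact hb.a_false_of_mem_blue_Ah hup hqB hy hzB.1
          · exact absurd hzB hhB
          · -- the dropped vertex of the piece is blue-attached: a B-slab point with the piece blue
            have hpB' : p (arm i) ∈ cluster ends (blue ζ') h := hzB.1
            rw [hζ', hb.cluster_blue_mixedRealR hup hqB, mem_redSetR_iff] at hpB'
            rcases hpB' with h' | ⟨j, -, hx'⟩ | ⟨h', -⟩ | ⟨r, hr, ⟨j, hj⟩, hr'⟩ | ⟨i', -, hx'⟩ |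
              ⟨k, -, hx'⟩
            · exact absurd h' (hb.hne_hp (arm i)).symm
            · exact absurd hx' (hb.p_notMem_U (arm i) j)
            · exact absurd h' (hb.hne_up (arm i)).symm
            · obtain rfl := hb.p_inj hr
              rw [flipPt_fst] at hj
              rw [flipPt_uP] at hr'
              rcases hq with ⟨hs, -⟩ | ⟨-, hB'⟩
              · rw [hs] at hj; simp at hj
              · rcases hB' (arm i) with h' | ⟨ha, -⟩
                · rw [h'] at hr'; exact absurd hr' (by decide)
                · exact ha i rfl
            · exact absurd hx' (hb.p_notMem_Ah (arm i) i')
            · exact absurd hx' (hb.p_notMem_F (arm i) k)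
          · exfalso
            rcases hBsub z hzB with ((h' | h') | ⟨r, hr⟩) | h'
            · exact hyh h'
            · exact hyu h'
            · exact hyp r hr.symm
            · exact hyo h'
      · intro ha
        refine ⟨x, ⟨?_, fun h' => hb.h_notMem_Ah i (h' ▸ hx)⟩, y, hxy⟩
        rw [hζ', hb.cluster_blue_mixedRealR hup hqB, mem_redSetR_iff]
        exact Or.inr (Or.inr (Or.inr (Or.inr (Or.inl ⟨i, by rw [flipPt_a, ha]; rfl, hx⟩))))
    cases ha : q.2.1 i with
    | false =>
      rw [flip_apply_of_mem (hmem.2 ha), hζ', hb.mixedRealR_apply_Ah hi, ha, if_neg (by decide),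
        Bool.not_not]
    | true =>
      rw [flip_apply_of_notMem (fun h' => by rw [hmem.1 h'] at ha; exact Bool.noConfusion ha), hζ',
        hb.mixedRealR_apply_Ah hi, ha, if_pos rfl]
  by_cases hUP : ∃ r, e ∈ clsUPR ends u p r
  · exfalso
    obtain ⟨r, hr⟩ := hUP
    exact h1 (hUP₀ r e hr)
  by_cases hX : ∃ r, e ∈ clsExtR ends u p Ah r
  · exfalso
    obtain ⟨r, hr⟩ := hX
    exact h2 (hX₀ r e hr)
  by_cases hF : ∃ k, e ∈ touches ends (F k)
  · obtain ⟨k, hk⟩ := hF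
    have hmem : e ∈ touches ends B ↔ q.2.2.2.2 k = false := by
      obtain ⟨x, y, hxy, hx, hy⟩ := hb.ends_of_touches_F hk
      constructor
      · rintro ⟨z, hzB, w, hzw⟩
        have hz : z = x ∨ z = y := by
          rw [hxy, Sym2.eq_iff] at hzw
          rcases hzw with ⟨h1, _⟩ | ⟨_, h2⟩
          · exact Or.inl h1.symm
          · exact Or.inr h2.symm
        rcases hz with rfl | rfl
        · exact hb.f_false_of_mem_blue_F hup hqB hx hzB.1
        · rcases hy with hy | rfl | ⟨hyh, hyu, hyp, hyo⟩
          · exact hb.f_false_of_mem_blue_F hup hqB hy hzB.1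
          · exact absurd hzB hhB
          · exfalso
            rcases hBsub z hzB with ((h' | h') | ⟨r, hr⟩) | h'
            · exact hyh h'
            · exact hyu h'
            · exact hyp r hr.symm
            · exact hyo h'
      · intro hf
        refine ⟨x, ⟨?_, fun h' => hb.h_notMem_F k (h' ▸ hx)⟩, y, hxy⟩
        rw [hζ', hb.cluster_blue_mixedRealR hup hqB, mem_redSetR_iff]
        exact Or.inr (Or.inr (Or.inr (Or.inr (Or.inr ⟨k, by rw [flipPt_f, hf]; rfl, hx⟩))))
    cases hf : q.2.2.2.2 k with
    | false =>
      rw [flip_apply_of_mem (hmem.2 hf), hζ', hb.mixedRealR_apply_F hk, hf, if_neg (by decide),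
        Bool.not_not]
    | true =>
      rw [flip_apply_of_notMem (fun h' => by rw [hmem.1 h'] at hf; exact Bool.noConfusion hf), hζ',
        hb.mixedRealR_apply_F hk, hf, if_pos rfl]
  · have hU' : ∀ j, e ∉ touches ends (U j) := fun j hj => hU ⟨j, hj⟩
    have hA' : ∀ i, e ∉ touches ends (Ah i) := fun i hi => hA ⟨i, hi⟩
    have hUP' : ∀ r, e ∉ clsUPR ends u p r := fun r hr => hUP ⟨r, hr⟩
    have hX' : ∀ r, e ∉ clsExtR ends u p Ah r := fun r hr => hX ⟨r, hr⟩
    have hF' : ∀ k, e ∉ touches ends (F k) := fun k hk => hF ⟨k, hk⟩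
    have hnot : e ∉ touches ends B := by
      rintro ⟨z, hzB, w, hzw⟩
      rcases hBsub z hzB with ((hzh | hzu) | ⟨r, hzp⟩) | hz
      · rw [hzh] at hzB; exact hhB hzB
      · rw [hzu] at hzw
        rcases hb.u_edges e w hzw with ⟨j, hj⟩ | ⟨r, hwp⟩
        · exact hU' j ⟨w, hj, u, ends_swap hzw⟩
        · rw [hwp] at hzw; exact hUP' r hzw
      · rw [← hzp] at hzw
        rcases hb.p_edges r e w hzw with hwu | ⟨i, -, hw⟩ | ⟨_, _, hwo⟩
        · rw [hwu] at hzw; exact hUP' r (ends_swap hzw)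
        · exact hA' i ⟨w, hw, p r, ends_swap hzw⟩
        · by_cases hwu : w = u
          · rw [hwu] at hzw; exact hUP' r (ends_swap hzw)
          · exact hX' r ⟨w, hzw, hwu, fun i hw => hwo (Or.inl (Or.inr (Set.mem_iUnion.2 ⟨i, hw⟩)))⟩
      · rcases hz with (hz | hz) | hz
        · obtain ⟨j, hj⟩ := Set.mem_iUnion.1 hz
          exact hU' j ⟨z, hj, w, hzw⟩
        · obtain ⟨i, hi⟩ := Set.mem_iUnion.1 hz
          exact hA' i ⟨z, hi, w, hzw⟩
        · obtain ⟨k, hk⟩ := Set.mem_iUnion.1 hz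
          exact hF' k ⟨z, hk, w, hzw⟩
    rw [flip_apply_of_notMem hnot, hζ', MixedBaseR.mixedRealR_apply_none hU' hA' hUP' hX' hF']

end BaseE

end MixedArms

end Summit.Ventures.PercRepro2
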